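import Literature.InformationTheory.QuantumCodes.TwistedToricErasureHalf
import Literature.InformationTheory.QuantumCodes.TwistedToricRotatedFamily
import HarnessLib

/-!
# The rotated toric codes `[[d² + 1, 2, d]]` (Kovalev–Pryadko) have loss threshold EXACTLY `1/2`

Topic `Literature/InformationTheory/QuantumCodes` (venture QEC, LADDER-QEC rung Q5; qec-type-03). All PROVED, no named fact, kernel
axioms. The explicit instance of `TwistedToric.twistedToric_loss_accuracyThreshold_eq_half` (`TwistedToricErasureHalf.lean`) for
type-08's cyclic rotated family (`TwistedToricRotatedFamily.lean`, `rotated_isCode`): `G_t = ℤ_{c_t}`, `c_t = 2t² + 2t + 1 =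
t² + (t+1)²`, `g₁ = 2t + 1` (an admissible `a`: `(t+1)(2t+1) = c_t + t`, `t(2t+1) = c_t − (t+1)`), `g₂ = 1` — the codes
`LP[1 + x^{2t+1}, 1 + x]` with parameters `[[2c_t, 2, 2t+1]] = [[d²+1, 2, d]]` (Kovalev–Pryadko 2013 Ex. 2 / 2012 Ex. 1):

* `rotated_systole` — `sys₁(Λ_t) = 2t + 1` for this choice of `a`;
* **`rotatedToric_loss_accuracyThreshold_eq_half`** — the loss-uncorrectability family of these codes has accuracy threshold
  EXACTLY `1/2` (growth check: `c_t e^{-c ⌊t/2⌋} → 0`).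

References: [KovalevPryadko2013Hyperbicycle] PRA 88 (2013) 012311, §III.B Ex. 2 («[[2t²+2(t+1)², 2, 2t+1]]»);
[KovalevPryadko2012] arXiv:1202.0928 §III.C Ex. 1; [StaceBarrettDoherty2009] PRL 102 (2009) 200501, p. 1–3.
-/

namespace Literature.InformationTheory.QuantumCodes

namespace TwistedToric

open Finset Matrix Filter Topology

/-- The size `c_t = 2t² + 2t + 1 = t² + (t+1)²` of the cyclic group of the `t`-th rotated toric code.
[cite: KovalevPryadko2013Hyperbicycle, §III.B Ex. 2 (c = t² + (t+1)²)] -/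
theorem rotated_c_eq (t : ℕ) : ((2 * t ^ 2 + 2 * t + 1 : ℕ) : ℤ) = (t : ℤ) ^ 2 + ((t : ℤ) + 1) ^ 2 := by
  push_cast; ring

/-- **`sys₁ = 2t + 1`** for the rotated lattice presented with `a = 2t + 1`. [cite: KovalevPryadko2012, §III.C Ex. 1 (distance 2t+1)] -/
theorem rotated_systole (t : ℕ) :
    systole (((2 * t + 1 : ℕ) : ℤ) : ZMod (2 * t ^ 2 + 2 * t + 1)) (1 : ZMod (2 * t ^ 2 + 2 * t + 1)) = 2 * t + 1 := by
  refine systole_cyclic (c := 2 * t ^ 2 + 2 * t + 1) (t := t) (a := ((2 * t + 1 : ℕ) : ℤ)) (rotated_c_eq t) ?_ ?_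
  · refine ⟨1, ?_⟩; push_cast; ring
  · refine ⟨1, ?_⟩; push_cast; ring

open Classical in
/-- ★ **Kovalev–Pryadko's rotated toric codes `[[d²+1, 2, d]]` have loss threshold EXACTLY `1/2`**: the accuracy threshold of the
loss-uncorrectability family of the codes `LP[1 + x^{2t+1}, 1 + x]` over `ℤ_{2t²+2t+1}` (`t = 0, 1, 2, …`) is `1/2` — an
instance of `twistedToric_loss_accuracyThreshold_eq_half` (`|G_t| = 2t²+2t+1`, `sys₁ = 2t+1`).
[cite: KovalevPryadko2013Hyperbicycle, §III.B Ex. 2 (the codes [[2t²+2(t+1)², 2, 2t+1]])] [cite: StaceBarrettDoherty2009, p. 1 (maximum tolerable loss rate 50%)] -/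
theorem rotatedToric_loss_accuracyThreshold_eq_half :
    accuracyThreshold (fun t y => ErasureDecoder.uncorrectableProb
      {z : ZMod (2 * t ^ 2 + 2 * t + 1) ⊕ ZMod (2 * t ^ 2 + 2 * t + 1) → ZMod 2 |
        (code (((2 * t + 1 : ℕ) : ℤ) : ZMod (2 * t ^ 2 + 2 * t + 1)) 1).HX *ᵥ z = 0}
      ((code (((2 * t + 1 : ℕ) : ℤ) : ZMod (2 * t ^ 2 + 2 * t + 1)) 1).rowSpZ :
        Set (ZMod (2 * t ^ 2 + 2 * t + 1) ⊕ ZMod (2 * t ^ 2 + 2 * t + 1) → ZMod 2)) y) = 1 / 2 := by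
  refine twistedToric_loss_accuracyThreshold_eq_half (Gs := fun t => ZMod (2 * t ^ 2 + 2 * t + 1))
    (fun t => (((2 * t + 1 : ℕ) : ℤ) : ZMod (2 * t ^ 2 + 2 * t + 1))) (fun t => 1) (fun t => gen_one _) ?_
  intro c hc
  -- `(2t²+2t+1) e^{-c ⌊t/2⌋} ≤ 3 e^{c/2} (t+1)² e^{-(c/2) t} → 0`
  have hlim := tendsto_card_mul_exp_neg_of_poly (ι := fun t => ZMod (2 * t ^ 2 + 2 * t + 1))
    (fun t => (univ : Finset (ZMod (2 * t ^ 2 + 2 * t + 1)))) (fun t => t) (A := 3) (m := 2)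
    (fun t => by
      rw [Finset.card_univ, ZMod.card]
      push_cast
      nlinarith)
    (fun t => le_rfl) (half_pos hc)
  have hlim2 : Tendsto (fun t : ℕ => Real.exp (c / 2) *
      (((univ : Finset (ZMod (2 * t ^ 2 + 2 * t + 1))).card : ℝ) * Real.exp (-(c / 2) * (t : ℝ)))) atTop (𝓝 0) := by
    have := hlim.const_mul (Real.exp (c / 2))
    rwa [mul_zero] at this
  refine squeeze_zero' (Filter.Eventually.of_forall fun t => by positivity) (Filter.Eventually.of_forall fun t => ?_) hlim2
  rw [Finset.card_univ, rotated_systole]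
  have hfloor : ((t : ℝ) - 1) / 2 ≤ (((2 * t + 1 - 1) / 4 : ℕ) : ℝ) := by
    have h1 : (2 * t + 1 - 1) / 4 = t / 2 := by omega
    rw [h1]
    have : (t : ℝ) - 1 ≤ 2 * ((t / 2 : ℕ) : ℝ) := by
      have : t - 1 ≤ 2 * (t / 2) := by omega
      have h2 : ((t - 1 : ℕ) : ℝ) ≤ ((2 * (t / 2) : ℕ) : ℝ) := by exact_mod_cast this
      rcases Nat.eq_zero_or_pos t with h0 | hpos
      · subst h0; simp
      · rw [Nat.cast_sub hpos] at h2; push_cast at h2; linarith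
    linarith
  have hexp : Real.exp (-c * (((2 * t + 1 - 1) / 4 : ℕ) : ℝ)) ≤ Real.exp (c / 2) * Real.exp (-(c / 2) * (t : ℝ)) := by
    rw [← Real.exp_add]
    apply Real.exp_le_exp.2
    nlinarith
  calc (Fintype.card (ZMod (2 * t ^ 2 + 2 * t + 1)) : ℝ) * Real.exp (-c * (((2 * t + 1 - 1) / 4 : ℕ) : ℝ))
      ≤ (Fintype.card (ZMod (2 * t ^ 2 + 2 * t + 1)) : ℝ) * (Real.exp (c / 2) * Real.exp (-(c / 2) * (t : ℝ))) :=
        mul_le_mul_of_nonneg_left hexp (Nat.cast_nonneg _)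
    _ = Real.exp (c / 2) * ((Fintype.card (ZMod (2 * t ^ 2 + 2 * t + 1)) : ℝ) * Real.exp (-(c / 2) * (t : ℝ))) := by
        ring

end TwistedToric

end Literature.InformationTheory.QuantumCodes
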